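import Literature.AlgebraicGeometry.HodgeTheory.AlgebraicMonodromyMumfordTate
import Literature.GroupTheory.ArithmeticGroups.UnitaryRealApproximation
import HarnessLib

/-!
# The unitary group of a non-degenerate hermitian form is Zariski dense in `GL_n(ℂ)`: a complex polynomial
# in the matrix entries vanishing on `U(W, h)` vanishes on `GL(W)` (Borel, *Linear Algebraic Groups*, 18.3
# with I.2.1; via the Cayley transform, Weyl / Platonov–Rapinchuk §7.1)

Family `hodge`, layer `Literature/AlgebraicGeometry/HodgeTheory`. THEOREM in the vocabulary of the tree's
`K`-points Zariski closure `glZariskiClosure` (`AlgebraicMonodromyMumfordTate`; closure = polynomials in the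
matrix entries): for a finite-dimensional complex `W` with a non-degenerate hermitian form `B` (Mathlib
sesquilinear, conjugate-linear in the first slot, `B.IsSymm`, `B.Nondegenerate`), EVERY subgroup
`Δ ≤ GL(W)` containing all `B`-unitary automorphisms has `glZariskiClosure Δ = GL(W)`
(`mem_glZariskiClosure_of_forall_isometry_mem`). This is "`U(p,q)` is a real form of `GL_n(ℂ)`, hence Zariski
dense" (Borel 18.3: the real points of a connected real group are dense; `U(p,q)_ℂ = GL_n`), proved here
WITHOUT algebraic groups, by the Cayley transform. Written by the prover seat `hodge-nonav-prover-A` (cell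
`hodge-nonav`) for the crux K1 `VeryGeneralDeckCommutatorsInHg` (`stmt-HodgeConjecture-19544`, lane-D
roadmap §2 (c)): it is the bridge from Carlson–Toledo's density on unitary groups
("`[U(h), U(h)] ⊆ Γ^Zar(ℂ)`", `commutator_mem_glZariskiClosure_of_prime_order`) to statements about all of
`GL / SL` (`SpecialLinearIdentityComponent`, `UnitaryCommutatorsIdentityComponent`).

Proof. Fix a basis `b`, the Gram matrix `H = (B(bᵢ, bⱼ))` (hermitian, `det H ≠ 0`), and a polynomial `P` in
the entries vanishing on the matrices of `Δ`. (1) `U(W, h)` contains the unit scalars and is stable under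
them, so for a unitary matrix `C` the polynomial `z ↦ P(z C)` vanishes on the unit circle, hence identically
(`smul_mem_zariskiClosureEndOfBasis_of_infinite`): `P(z C) = 0` for ALL `z ∈ ℂ`. (2) For `X` in the real
vector space `𝔲 = {X : Xᴴ H = −H X}` with `det (1 − X) ≠ 0`, the Cayley transform `(1+X)(1−X)⁻¹` is unitary
(tree `RealApproximation.cayley_unitary`), so the POLYNOMIAL `F_z(X) := P(z (1+X) adj(1−X)) · det(1−X)`
vanishes on `𝔲`. (3) `𝔲` is a real form of `M_n(ℂ)`: every `M = Y + iX` with `X, Y ∈ 𝔲`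
(`exists_skew_add_I_smul_skew`), and `t ↦ F_z(Y + tX)` is a one-variable polynomial vanishing on `ℝ`, hence
at `t = i`: `F_z` vanishes on `M_n(ℂ)` (`eval_eq_zero_of_forall_mem_skewSet`). (4) Every `N` with
`det (N + 1) ≠ 0` is a Cayley transform, and every `M₀` is `s N` for such an `N` and a scalar `s` (off the
finitely many `s` with `det (M₀ + s) = 0`); unwinding, `P(M₀) = 0`.

## What is proved
* `smul_mem_zariskiClosureEndOfBasis_of_infinite` — lines through `0`: if `t • n ∈ S` for infinitely many
  `t`, then `t • n ∈ cl(S)` for all `t` (any field).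
* `eval_eq_zero_of_forall_mem_skewSet` — the polynomial identity principle on the real form `𝔲`
  (`𝔲 ⊕ i𝔲 = M_n(ℂ)`).
* **`mem_glZariskiClosure_of_forall_isometry_mem`** — the density theorem.
Private plumbing (uncited linear algebra): the Gram matrix `H = (B(bᵢ, bⱼ))` of a sesquilinear form is
hermitian and invertible, `B(f bⱼ, f bₖ) = ([f]ᴴ H [f])ⱼₖ`, "isometry iff `[f]ᴴ H [f] = H`", unit scalars are
isometries, and the decomposition `M = ½(M − M†) + i·(−i/2)(M + M†)`.

## References
* [Borel1991] A. Borel, *Linear Algebraic Groups*, 2nd ed., GTM 126 (1991), 18.3 (density of real/rational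
  points of connected groups; Cor. 18.3), I.2.1.
* [PlatonovRapinchuk1994] V. Platonov, A. Rapinchuk, *Algebraic Groups and Number Theory* (1994), §7.1
  (Cayley parametrisation of unitary groups; rationality).
* [CarlsonMullerStachPeters2017] J. Carlson, S. Müller-Stach, C. Peters, *Period Mappings and Period
  Domains*, 2nd ed. (2017), Lemma–Definition 15.3.7 (the vocabulary `Γ^Zar`).
-/

noncomputable section

open Literature.AlgebraicGeometry.Motives Matrix
open Literature.GroupTheory.ArithmeticGroups.RealApproximation
open scoped ComplexConjugate

namespace Literature.AlgebraicGeometry.HodgeTheory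

/-! ### §1 Lines through the origin in the entry-closure -/

section Lines

universe u v

variable {K : Type u} [Field K] {V : Type v} [AddCommGroup V] [Module K V]
variable {ι : Type*} [Fintype ι] [DecidableEq ι]

/-- **A line through the origin**: if `t • n ∈ S` for infinitely many scalars `t`, then `t • n` lies in the
entry-closure of `S` for every `t` (a one-variable polynomial with infinitely many roots vanishes; companion
of the tree's `one_add_smul_mem_zariskiClosureEndOfBasis`). [cite: Borel1991, I.2.1] -/
theorem smul_mem_zariskiClosureEndOfBasis_of_infinite (b : Module.Basis ι K V) {S : Set (Module.End K V)}
    (n : Module.End K V) (hS : {t : K | t • n ∈ S}.Infinite) (t : K) :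
    t • n ∈ zariskiClosureEndOfBasis b S := by
  intro P hP
  set N := LinearMap.toMatrix b b n with hN
  let Q : Polynomial K := MvPolynomial.aeval (fun ij : ι × ι => Polynomial.C (N ij.1 ij.2) * Polynomial.X) P
  have hQ : ∀ s : K, Q.eval s =
      MvPolynomial.eval (fun ij : ι × ι => LinearMap.toMatrix b b (s • n) ij.1 ij.2) P := by
    intro s
    rw [LinearEquiv.map_smul, ← hN]
    change Polynomial.evalRingHom s (MvPolynomial.eval₂ Polynomial.C _ P) = _
    rw [MvPolynomial.eval₂_comp_left, MvPolynomial.eval]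
    refine congrArg₂ (fun f c => MvPolynomial.eval₂ f c P) ?_ (funext fun ij => ?_)
    · ext a
      simp
    · simp only [Function.comp_apply, Polynomial.coe_evalRingHom, Polynomial.eval_mul, Polynomial.eval_C,
        Polynomial.eval_X, Matrix.smul_apply, smul_eq_mul, mul_comm s]
  have hroots : {x : K | Q.IsRoot x}.Infinite := by
    refine hS.mono fun s hs => ?_
    rw [Set.mem_setOf_eq, Polynomial.IsRoot.def, hQ]
    exact hP _ hs
  have hQ0 : Q = 0 := Polynomial.eq_zero_of_infinite_isRoot Q hroots
  rw [← hQ t, hQ0, Polynomial.eval_zero]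

end Lines

/-! ### §2 The Gram matrix of a sesquilinear form; isometries on matrices -/

section Gram

variable {W : Type*} [AddCommGroup W] [Module ℂ W] {ι : Type*} [Fintype ι] [DecidableEq ι]
  {B : W →ₗ⋆[ℂ] W →ₗ[ℂ] ℂ}

/-- **`B(f bⱼ, f bₖ) = ([f]ᴴ · H · [f])ⱼₖ`** with `H = (B(bᵢ, bₗ))` the Gram matrix and `[f]` the matrix of
`f` in the basis `b` (Mathlib convention: column `j` of `[f]` = coordinates of `f bⱼ`; `B` conjugate-linear in
the first slot). [folklore] -/
private theorem apply_basis_eq_conjTranspose_mul_gram_mul (b : Module.Basis ι ℂ W) (f : W →ₗ[ℂ] W) (j k : ι) :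
    B (f (b j)) (f (b k)) =
      ((LinearMap.toMatrix b b f)ᴴ * Matrix.of (fun i l => B (b i) (b l)) * LinearMap.toMatrix b b f) j k := by
  have hcol : ∀ j, f (b j) = ∑ i, LinearMap.toMatrix b b f i j • b i := fun j => by
    simp_rw [LinearMap.toMatrix_apply]
    exact (b.sum_repr (f (b j))).symm
  rw [hcol j, hcol k, LinearMap.map_sum₂]
  simp only [map_sum, map_smul, LinearMap.smul_apply, LinearMap.map_smulₛₗ, smul_eq_mul, Matrix.mul_apply,
    Matrix.conjTranspose_apply, Matrix.of_apply, Finset.sum_mul, starRingEnd_apply]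
  rw [Finset.sum_comm]
  refine Finset.sum_congr rfl fun l _ => Finset.sum_congr rfl fun i _ => ?_
  ring

omit [Fintype ι] [DecidableEq ι] in
/-- The Gram matrix of a hermitian form is hermitian. [folklore] -/
private theorem conjTranspose_gram (hB : B.IsSymm) (b : Module.Basis ι ℂ W) :
    (Matrix.of fun i l => B (b i) (b l))ᴴ = Matrix.of fun i l => B (b i) (b l) := by
  ext i l
  rw [Matrix.conjTranspose_apply, Matrix.of_apply, Matrix.of_apply, Complex.star_def]
  exact hB.eq (b l) (b i)

/-- **`f` is a `B`-isometry iff `[f]ᴴ H [f] = H`.** [folklore] -/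
private theorem isometry_iff_conjTranspose_mul_gram_mul (b : Module.Basis ι ℂ W) (f : W →ₗ[ℂ] W) :
    (∀ x y, B (f x) (f y) = B x y) ↔
      (LinearMap.toMatrix b b f)ᴴ * Matrix.of (fun i l => B (b i) (b l)) * LinearMap.toMatrix b b f =
        Matrix.of fun i l => B (b i) (b l) := by
  constructor
  · intro h
    ext j k
    rw [← apply_basis_eq_conjTranspose_mul_gram_mul, Matrix.of_apply, h]
  · intro h x y
    have hf : ∀ j k, B (f (b j)) (f (b k)) = B (b j) (b k) := fun j k => by
      rw [apply_basis_eq_conjTranspose_mul_gram_mul, h, Matrix.of_apply]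
    rw [← b.sum_repr x, ← b.sum_repr y]
    simp only [map_sum, map_smul, LinearMap.sum_apply, LinearMap.smul_apply, LinearMap.map_smulₛₗ, hf]

/-- **The Gram matrix of a non-degenerate form is invertible**: a null vector `H v = 0` gives
`y = Σ vⱼ bⱼ ≠ 0` with `B(x, y) = 0` for all `x`. [folklore] -/
private theorem det_hermitianGram_ne_zero (hBn : B.Nondegenerate) (b : Module.Basis ι ℂ W) :
    (Matrix.of fun i l => B (b i) (b l)).det ≠ 0 := by
  intro hdet
  obtain ⟨v, hv0, hv⟩ := Matrix.exists_mulVec_eq_zero_iff.2 hdet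
  set y : W := ∑ j, v j • b j with hy
  have hby : ∀ i, B (b i) y = 0 := fun i => by
    have h := congrFun hv i
    simp only [Matrix.mulVec, dotProduct, Matrix.of_apply, Pi.zero_apply] at h
    rw [hy]
    simp only [map_sum, map_smul, smul_eq_mul]
    simpa only [mul_comm] using h
  have hxy : ∀ x, B x y = 0 := fun x => by
    rw [← b.sum_repr x]
    simp only [LinearMap.map_sum₂, LinearMap.map_smulₛₗ₂, hby, smul_zero, Finset.sum_const_zero]
  have hy0 : y = 0 := hBn.2 y hxy
  apply hv0
  have h : b.equivFun.symm v = 0 := by rw [Module.Basis.equivFun_symm_apply, ← hy, hy0]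
  exact b.equivFun.symm.map_eq_zero_iff.mp h

omit [Fintype ι] [DecidableEq ι] in
/-- Unit scalar multiples of isometries are isometries (`U(W, h) ⊇ U(1)`). [folklore] -/
private theorem isometry_smul_of_conj_mul_self {u : W →ₗ[ℂ] W} (hu : ∀ x y, B (u x) (u y) = B x y) {z : ℂ}
    (hz : conj z * z = 1) : ∀ x y, B ((z • u) x) ((z • u) y) = B x y := by
  intro x y
  simp only [LinearMap.smul_apply, LinearMap.map_smulₛₗ₂, map_smul, smul_eq_mul, starRingEnd_apply, hu x y]
  simp only [starRingEnd_apply] at hz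
  linear_combination (B x y) * hz

end Gram

/-! ### §3 The real form `𝔲 = {X : Xᴴ H = −H X}` of `M_n(ℂ)` -/

section RealForm

variable {ι : Type*} [Fintype ι] [DecidableEq ι] {H : Matrix ι ι ℂ}

omit [DecidableEq ι] in
/-- `𝔲` is closed under addition. [folklore] -/
private theorem add_mem_skewSet {X Y : Matrix ι ι ℂ} (hX : X ∈ skewSet H) (hY : Y ∈ skewSet H) : X + Y ∈ skewSet H := by
  rw [mem_skewSet_iff] at hX hY ⊢
  rw [Matrix.conjTranspose_add, Matrix.add_mul, hX, hY, Matrix.mul_add, neg_add]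

omit [DecidableEq ι] in
/-- `𝔲` is closed under REAL scalars. [folklore] -/
private theorem real_smul_mem_skewSet {X : Matrix ι ι ℂ} (hX : X ∈ skewSet H) (r : ℝ) : ((r : ℂ) • X) ∈ skewSet H := by
  rw [mem_skewSet_iff] at hX ⊢
  rw [Matrix.conjTranspose_smul, Complex.star_def, Complex.conj_ofReal, Matrix.smul_mul, hX, Matrix.mul_smul,
    smul_neg]

/-- **`M_n(ℂ) = 𝔲 ⊕ i 𝔲`**: every complex matrix is `Y + i X` with `X, Y` `H`-skew-adjoint, namely
`Y = ½ (M − M†)`, `X = −(i/2)(M + M†)`, `M† := H⁻¹ Mᴴ H` the `H`-adjoint (`H` hermitian invertible).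
[folklore] -/
private theorem exists_skew_add_I_smul_skew (hH : Hᴴ = H) (hHd : IsUnit H.det) (M : Matrix ι ι ℂ) :
    ∃ X Y : Matrix ι ι ℂ, X ∈ skewSet H ∧ Y ∈ skewSet H ∧ M = Y + Complex.I • X := by
  set Md : Matrix ι ι ℂ := H⁻¹ * Mᴴ * H with hMd
  -- the adjoint's two identities
  have h1 : Mdᴴ * H = H * M := by
    rw [hMd, Matrix.conjTranspose_mul, Matrix.conjTranspose_mul, Matrix.conjTranspose_conjTranspose, hH,
      Matrix.conjTranspose_nonsing_inv, hH, Matrix.mul_assoc, Matrix.mul_assoc, Matrix.nonsing_inv_mul _ hHd,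
      Matrix.mul_one]
  have h2 : H * Md = Mᴴ * H := by
    rw [hMd, ← Matrix.mul_assoc, ← Matrix.mul_assoc, Matrix.mul_nonsing_inv _ hHd, Matrix.one_mul]
  refine ⟨((2 : ℂ)⁻¹ * -Complex.I) • (M + Md), (2 : ℂ)⁻¹ • (M - Md), ?_, ?_, ?_⟩
  · rw [mem_skewSet_iff, Matrix.conjTranspose_smul, Matrix.smul_mul, Matrix.mul_smul, Matrix.conjTranspose_add,
      Matrix.add_mul, h1, Matrix.mul_add, h2, ← smul_neg]
    have hs : star ((2 : ℂ)⁻¹ * -Complex.I) = -((2 : ℂ)⁻¹ * -Complex.I) := by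
      rw [Complex.star_def, map_mul, map_neg, Complex.conj_I, map_inv₀, map_ofNat]
      ring
    rw [hs, neg_smul, smul_neg, add_comm (Mᴴ * H)]
  · rw [mem_skewSet_iff, Matrix.conjTranspose_smul, Matrix.smul_mul, Matrix.mul_smul, Matrix.conjTranspose_sub,
      Matrix.sub_mul, h1, Matrix.mul_sub, h2, ← smul_neg, neg_sub]
    have hs : star ((2 : ℂ)⁻¹) = (2 : ℂ)⁻¹ := by
      rw [Complex.star_def, map_inv₀, map_ofNat]
    rw [hs]
  · rw [smul_smul, show Complex.I * ((2 : ℂ)⁻¹ * -Complex.I) = (2 : ℂ)⁻¹ by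
        linear_combination (-(2 : ℂ)⁻¹) * Complex.I_mul_I,
      ← smul_add, sub_add_add_cancel, ← two_smul ℂ M, smul_smul, inv_mul_cancel₀ (two_ne_zero : (2 : ℂ) ≠ 0),
      one_smul]

/-- **The polynomial identity principle on the real form `𝔲`**: a complex polynomial in the matrix entries
that vanishes on `𝔲 = {X : Xᴴ H = −H X}` (`H` hermitian invertible) vanishes on all of `M_n(ℂ)` — for
`M = Y + iX`, the one-variable polynomial `t ↦ F(Y + tX)` vanishes on `ℝ`, hence at `t = i`.
[cite: Borel1991, 18.3] -/
theorem eval_eq_zero_of_forall_mem_skewSet (hH : Hᴴ = H) (hHd : IsUnit H.det) (F : MvPolynomial (ι × ι) ℂ)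
    (hF : ∀ X ∈ skewSet H, MvPolynomial.eval (fun ij : ι × ι => X ij.1 ij.2) F = 0) (M : Matrix ι ι ℂ) :
    MvPolynomial.eval (fun ij : ι × ι => M ij.1 ij.2) F = 0 := by
  obtain ⟨X, Y, hX, hY, rfl⟩ := exists_skew_add_I_smul_skew hH hHd M
  let Q : Polynomial ℂ :=
    MvPolynomial.aeval (fun ij : ι × ι => Polynomial.C (Y ij.1 ij.2) + Polynomial.C (X ij.1 ij.2) * Polynomial.X) F
  have hQ : ∀ s : ℂ, Q.eval s = MvPolynomial.eval (fun ij : ι × ι => (Y + s • X) ij.1 ij.2) F := by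
    intro s
    change Polynomial.evalRingHom s (MvPolynomial.eval₂ Polynomial.C _ F) = _
    rw [MvPolynomial.eval₂_comp_left, MvPolynomial.eval]
    refine congrArg₂ (fun f c => MvPolynomial.eval₂ f c F) ?_ (funext fun ij => ?_)
    · ext a
      simp
    · simp only [Function.comp_apply, Polynomial.coe_evalRingHom, Polynomial.eval_add, Polynomial.eval_C,
        Polynomial.eval_mul, Polynomial.eval_X, Matrix.add_apply, Matrix.smul_apply, smul_eq_mul, mul_comm s]
  have hroots : {x : ℂ | Q.IsRoot x}.Infinite := by
    refine (Set.infinite_range_of_injective Complex.ofReal_injective).mono ?_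
    rintro _ ⟨r, rfl⟩
    rw [Set.mem_setOf_eq, Polynomial.IsRoot.def, hQ]
    exact hF _ (add_mem_skewSet hY (real_smul_mem_skewSet hX r))
  have hQ0 : Q = 0 := Polynomial.eq_zero_of_infinite_isRoot Q hroots
  rw [← hQ Complex.I, hQ0, Polynomial.eval_zero]

end RealForm

/-! ### §4 The density theorem -/

section Density

variable {W : Type} [AddCommGroup W] [Module ℂ W] [FiniteDimensional ℂ W] {B : W →ₗ⋆[ℂ] W →ₗ[ℂ] ℂ}

omit [FiniteDimensional ℂ W] in
/-- Every matrix with unit determinant is the matrix of an automorphism. [folklore] -/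
private theorem exists_linearEquiv_toMatrix_eq' {ι : Type*} [Fintype ι] [DecidableEq ι] (b : Module.Basis ι ℂ W)
    (N : Matrix ι ι ℂ) (hN : IsUnit N.det) : ∃ g : W ≃ₗ[ℂ] W, LinearMap.toMatrix b b (g : Module.End ℂ W) = N := by
  refine ⟨Matrix.toLinearEquiv b N hN, ?_⟩
  have h : ((Matrix.toLinearEquiv b N hN : W ≃ₗ[ℂ] W) : Module.End ℂ W) = Matrix.toLin b b N :=
    LinearMap.ext fun x => Matrix.toLinearEquiv_apply b N hN x
  rw [h, LinearMap.toMatrix_toLin]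

/-- A matrix `C` with `Cᴴ H C = H` (`H` with `det H ≠ 0`) is invertible. [folklore] -/
private theorem isUnit_det_of_conjTranspose_mul_mul {ι : Type*} [Fintype ι] [DecidableEq ι] {H C : Matrix ι ι ℂ}
    (hHd : H.det ≠ 0) (hC : Cᴴ * H * C = H) : IsUnit C.det := by
  rw [isUnit_iff_ne_zero]
  intro h0
  have h := congrArg Matrix.det hC
  rw [Matrix.det_mul, Matrix.det_mul, h0, mul_zero] at h
  exact hHd h.symm

/-- **`U(W, h)` is Zariski dense in `GL(W)`** (Borel 18.3 / the Cayley parametrisation): for a finite-dimensional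
complex `W` with a non-degenerate hermitian form `B`, every subgroup `Δ ≤ GL(W)` containing all `B`-unitary
automorphisms has `glZariskiClosure Δ = GL(W)` — every complex polynomial in the matrix entries vanishing on
`U(W, h)` vanishes identically on `GL(W)`. [cite: Borel1991, 18.3] [cite: PlatonovRapinchuk1994, §7.1] -/
theorem mem_glZariskiClosure_of_forall_isometry_mem (hB : B.IsSymm) (hBn : B.Nondegenerate)
    {Δ : Subgroup (W ≃ₗ[ℂ] W)} (hΔ : ∀ u : W ≃ₗ[ℂ] W, (∀ x y, B (u x) (u y) = B x y) → u ∈ Δ)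
    (g : W ≃ₗ[ℂ] W) : g ∈ glZariskiClosure Δ := by
  classical
  let b := Module.finBasis ℂ W
  set H : Matrix (Fin (Module.finrank ℂ W)) (Fin (Module.finrank ℂ W)) ℂ := Matrix.of fun i l => B (b i) (b l)
    with hHdef
  have hH : Hᴴ = H := conjTranspose_gram hB b
  have hHd0 : H.det ≠ 0 := det_hermitianGram_ne_zero hBn b
  have hHd : IsUnit H.det := isUnit_iff_ne_zero.2 hHd0
  rw [mem_glZariskiClosure_iff, ← zariskiClosureEnd_basis_indep b]
  intro P hP
  -- Step 1: `P(z • C) = 0` for every unitary matrix `C` and every `z ∈ ℂ`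
  have step1 : ∀ C : Matrix _ _ ℂ, Cᴴ * H * C = H →
      ∀ z : ℂ, MvPolynomial.eval (fun ij : _ × _ => (z • C) ij.1 ij.2) P = 0 := by
    intro C hC z
    obtain ⟨u, hu⟩ := exists_linearEquiv_toMatrix_eq' b C (isUnit_det_of_conjTranspose_mul_mul hHd0 hC)
    have hiso : ∀ x y, B (u x) (u y) = B x y := by
      have h := (isometry_iff_conjTranspose_mul_gram_mul (B := B) b (u : Module.End ℂ W)).2 (by rw [hu]; exact hC)
      simpa only [LinearEquiv.coe_coe] using h
    have hline := smul_mem_zariskiClosureEndOfBasis_of_infinite b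
      (S := (fun h : W ≃ₗ[ℂ] W => (h : Module.End ℂ W)) '' (Δ : Set (W ≃ₗ[ℂ] W))) (u : Module.End ℂ W) ?_ z
    · have h := hline P hP
      rwa [LinearEquiv.map_smul, hu] at h
    -- the unit circle: `circ r • u ∈ Δ` for every real `r`
    refine (Set.infinite_range_of_injective circ_injective).mono ?_
    rintro _ ⟨r, rfl⟩
    have hz0 : circ r ≠ 0 := fun h => by simpa [h] using conj_circ_mul_circ r
    refine ⟨LinearEquiv.smulOfNeZero ℂ W (circ r) hz0 * u, hΔ _ fun x y => ?_, ?_⟩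
    · have h := isometry_smul_of_conj_mul_self (B := B) (u := (u : Module.End ℂ W))
        (by simpa only [LinearEquiv.coe_coe] using hiso) (conj_circ_mul_circ r) x y
      simpa [LinearMap.smul_apply] using h
    · ext x
      simp
  -- Step 2: the polynomial `F_z(X) = P(z (1+X) adj(1-X)) · det(1-X)` vanishes on `𝔲`
  set Xg := Matrix.mvPolynomialX (Fin (Module.finrank ℂ W)) (Fin (Module.finrank ℂ W)) ℂ with hXg
  let G : ℂ → Matrix _ _ (MvPolynomial (Fin (Module.finrank ℂ W) × Fin (Module.finrank ℂ W)) ℂ) :=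
    fun z => Matrix.diagonal (fun _ => MvPolynomial.C z) * ((1 + Xg) * (1 - Xg).adjugate)
  let F : ℂ → MvPolynomial (Fin (Module.finrank ℂ W) × Fin (Module.finrank ℂ W)) ℂ :=
    fun z => MvPolynomial.bind₁ (fun ij => G z ij.1 ij.2) P * (1 - Xg).det
  have hGeval : ∀ (z : ℂ) (X : Matrix _ _ ℂ),
      (MvPolynomial.eval fun ij : _ × _ => X ij.1 ij.2).mapMatrix (G z) = z • ((1 + X) * (1 - X).adjugate) := by
    intro z X
    rw [map_mul, map_mul, RingHom.map_adjugate, map_sub, map_add, map_one, hXg, Matrix.mvPolynomialX_mapMatrix_eval,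
      Matrix.smul_eq_diagonal_mul]
    congr 1
    rw [RingHom.mapMatrix_apply, Matrix.diagonal_map (by simp)]
    simp
  have hFeval : ∀ (z : ℂ) (X : Matrix _ _ ℂ), MvPolynomial.eval (fun ij : _ × _ => X ij.1 ij.2) (F z) =
      MvPolynomial.eval (fun ij : _ × _ => (z • ((1 + X) * (1 - X).adjugate)) ij.1 ij.2) P * (1 - X).det := by
    intro z X
    rw [map_mul, RingHom.map_det, map_sub, map_one, hXg, Matrix.mvPolynomialX_mapMatrix_eval]
    congr 1
    rw [MvPolynomial.eval, MvPolynomial.eval₂Hom_bind₁, ← MvPolynomial.eval, ← MvPolynomial.eval]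
    refine congrArg (fun c => MvPolynomial.eval c P) (funext fun ij => ?_)
    rw [← hGeval z X, RingHom.mapMatrix_apply, Matrix.map_apply]
  have step2 : ∀ z : ℂ, ∀ X ∈ skewSet H, MvPolynomial.eval (fun ij : _ × _ => X ij.1 ij.2) (F z) = 0 := by
    intro z X hX
    rw [hFeval]
    by_cases hdet : (1 - X).det = 0
    · rw [hdet, mul_zero]
    have hu : IsUnit (1 - X).det := isUnit_iff_ne_zero.2 hdet
    -- `(1+X) adj(1-X) = det(1-X) • cayley X`
    have hadj : (1 + X) * (1 - X).adjugate = (1 - X).det • cayley X := by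
      rw [cayley, Matrix.inv_def, Ring.inverse_eq_inv', Matrix.mul_smul, smul_smul, mul_inv_cancel₀ hdet, one_smul]
    rw [hadj, smul_smul, step1 _ (cayley_unitary hX hu), zero_mul]
  -- Step 3: `F_z` vanishes on all of `M_n(ℂ)`
  have step3 : ∀ (z : ℂ) (M : Matrix _ _ ℂ), MvPolynomial.eval (fun ij : _ × _ => M ij.1 ij.2) (F z) = 0 :=
    fun z M => eval_eq_zero_of_forall_mem_skewSet hH hHd (F z) (step2 z) M
  -- Step 4: the target matrix `M₀ = [g]` is `s • cayley X`
  set M₀ := LinearMap.toMatrix b b (g : Module.End ℂ W) with hM₀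
  -- a scalar `s ≠ 0` with `det (M₀ + s • 1) ≠ 0`
  obtain ⟨s, hs0, hs⟩ : ∃ s : ℂ, s ≠ 0 ∧ (M₀ + s • (1 : Matrix _ _ ℂ)).det ≠ 0 := by
    have hfin : {s : ℂ | (M₀ + s • (1 : Matrix _ _ ℂ)).det = 0}.Finite := by
      have hroots : {s : ℂ | (M₀ + s • (1 : Matrix _ _ ℂ)).det = 0} ⊆ {s : ℂ | ((-M₀).charpoly).IsRoot s} := by
        intro s hs
        rw [Set.mem_setOf_eq, Polynomial.IsRoot.def, Matrix.eval_charpoly, sub_neg_eq_add, add_comm,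
          Matrix.scalar_apply, ← Matrix.smul_one_eq_diagonal]
        exact hs
      exact (Polynomial.finite_setOf_isRoot (Matrix.charpoly_monic (-M₀)).ne_zero).subset hroots
    obtain ⟨s, hs⟩ := (hfin.union (Set.finite_singleton (0 : ℂ))).infinite_compl.nonempty
    simp only [Set.mem_compl_iff, Set.mem_union, Set.mem_setOf_eq, Set.mem_singleton_iff, not_or] at hs
    exact ⟨s, hs.2, hs.1⟩
  set N : Matrix _ _ ℂ := s⁻¹ • M₀ with hN
  have hN1 : IsUnit (N + 1).det := by
    have h : N + 1 = s⁻¹ • (M₀ + s • (1 : Matrix _ _ ℂ)) := by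
      rw [hN, smul_add, smul_smul, inv_mul_cancel₀ hs0, one_smul]
    rw [h, Matrix.det_smul, isUnit_iff_ne_zero]
    exact mul_ne_zero (pow_ne_zero _ (inv_ne_zero hs0)) hs
  -- the inverse Cayley transform of `N`
  set X : Matrix _ _ ℂ := (N - 1) * (N + 1)⁻¹ with hXdef
  have h1X : (1 - X) * (N + 1) = (2 : ℂ) • (1 : Matrix _ _ ℂ) := by
    rw [hXdef, sub_mul, Matrix.one_mul, Matrix.mul_assoc, Matrix.nonsing_inv_mul _ hN1, Matrix.mul_one, two_smul]
    abel
  have hdet1X : (1 - X).det ≠ 0 := by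
    have h := congrArg Matrix.det h1X
    rw [Matrix.det_mul, Matrix.det_smul, Matrix.det_one, mul_one] at h
    intro h0
    rw [h0, zero_mul] at h
    exact pow_ne_zero _ two_ne_zero h.symm
  have hNX : N * (1 - X) = 1 + X := by
    have key : N * (1 - X) * (N + 1) = (1 + X) * (N + 1) := by
      rw [Matrix.mul_assoc, h1X, hXdef, add_mul, Matrix.one_mul, Matrix.mul_assoc, Matrix.nonsing_inv_mul _ hN1,
        Matrix.mul_one, Matrix.mul_smul, Matrix.mul_one, two_smul]
      abel
    calc N * (1 - X) = N * (1 - X) * (N + 1) * (N + 1)⁻¹ := by rw [Matrix.mul_nonsing_inv_cancel_right _ _ hN1]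
      _ = (1 + X) * (N + 1) * (N + 1)⁻¹ := by rw [key]
      _ = 1 + X := by rw [Matrix.mul_nonsing_inv_cancel_right _ _ hN1]
  have hcay : cayley X = N := cayley_eq_of_mul_eq (isUnit_iff_ne_zero.2 hdet1X) hNX
  have hadj : (1 + X) * (1 - X).adjugate = (1 - X).det • N := by
    rw [← hcay, cayley, Matrix.inv_def, Ring.inverse_eq_inv', Matrix.mul_smul, smul_smul, mul_inv_cancel₀ hdet1X,
      one_smul]
  -- unwind: `F_z(X) = 0` with `z = s / det(1 - X)` says `P(M₀) · det(1-X) = 0`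
  have h := step3 (s * ((1 - X).det)⁻¹) X
  rw [hFeval, hadj, smul_smul, mul_assoc, inv_mul_cancel₀ hdet1X, mul_one, hN, smul_smul, mul_inv_cancel₀ hs0,
    one_smul] at h
  exact (mul_eq_zero.1 h).resolve_right hdet1X

end Density

end Literature.AlgebraicGeometry.HodgeTheory

end
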